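import Literature.AlgebraicGeometry.Frobenioids.FactorizationTransport
import Literature.AlgebraicGeometry.Frobenioids.PerfFactorialWeak
import Literature.AlgebraicGeometry.Frobenioids.PerfFactorialPerfection
import HarnessLib

/-!
# Frobenioids I, Def. 2.4 (i), WEAK form: (c) + (d_ord) + (d_res) + (d_cof) are invariant under
# isomorphisms of monoids; `M` weakly perf-factorial ⇒ `M^pf` weakly perf-factorial (with cofinality)

Mochizuki, *The geometry of Frobenioids I*, Kyushu J. Math. **62** (2008), §2, Definition 2.4 (i),
kurims pp. 47–48 [cite: MochizukiFrdI2008, Def. 2.4(i) p.47] ("Finally, one verifies immediately that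
`M^pf`, `M^rlf` are also perf-factorial").

abc-iut cell, F-L2d2-1 / F-L2d2-2 repair chain (seat abc-iut-L2-d2).  `FactorizationTransport.lean` (seat
abc-iut-L1-t2) proves that conditions (c), (d) of Def. 2.4 (i) — packaged as `Factorization.Cond Q` for a
monoid `Q` in the role of `M^pf` — transport along `Q ≅ Q'`, whence `IsPerfFactorial` is isomorphism
invariant and "`M^pf` is perf-factorial".  The cell's WEAK notion (`IsPerfFactorialWeak` = (a)(b)(c) +
(d_ord) + (d_res), `PerfFactorialWeak.lean`) and the cofinality clause (d_cof) of the [EtTh] vocabulary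
`IsPerfFactorialCof` ("for every `a ∈ M^rlf`, there exists an `a' ∈ M^pf` such that `a' ≥ a`", [EtTh]
p.75; `FrdIVocabularyWeak.lean`) need the same bookkeeping before ANY instance presented up to
isomorphism — e.g. a divisor monoid `Φ₀(Y) ≅ ∏_J ℤ≥0` — can use `PiNat.isPerfFactorialCof`.  THIS FILE:

* `Factorization.CondWeak Q` = (c) + (d_ord) + (d_res) for `Q` in the role of `M^pf`, and
  `Factorization.Cofinal Q` = (d_cof); `CondWeak.of_mulEquiv`, `Cofinal.of_mulEquiv` (transport along
  `Q ≅ Q'`, via abc-iut-L1-t2's `fmap_congr` / `piR` / `piP`);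
* the bridge `isPerfFactorialWeak_iff` (`IsPerfFactorialWeak M` ⟺ (a) ∧ (b) ∧ `CondWeak (M^pf)`) and
  `IsPerfFactorialWeak.rlfCofinal_iff` ((d_cof) on `h.Rlf` ⟺ `Cofinal (M^pf)`);
* **`IsPerfFactorialWeak.of_mulEquiv`**, **`IsPerfFactorialWeak.rlfCofinal_of_mulEquiv`** (isomorphism
  invariance of the weak notion and of (d_cof)); **`IsPerfFactorialWeak.perfection`**,
  **`IsPerfFactorialWeak.rlfCofinal_perfection`** ("`M^pf` is [weakly] perf-factorial", with cofinality).

HONEST FRAMING: classical monoid algebra about a definition; nothing here bears on [IUTchIII] Cor. 3.12.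
-/

noncomputable section

namespace Literature.AlgebraicGeometry.Frobenioids

open Function

universe u

namespace Factorization

variable (Q : Type u) [CommMonoid Q]

/-- **Conditions (c) + (d_ord) + (d_res)** (the weak form of Def. 2.4 (i)(c)(d) adopted by the abc-iut
cell, F-L2d2-1) for the monoid `Q` in the role of `M^pf` — the fields of `IsPerfFactorialWeak` from
`bounded` on, with `factorMap ↦ fmap Q`, `pfFactorToRlfFactor ↦ pToR Q`.
[cite: MochizukiFrdI2008, Def. 2.4(i) p.47] -/
structure CondWeak : Prop where
  /-- (c) well-defined: each `Bound_{𝔮 ∪ {0}}(a)` is bounded -/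
  bounded : ∀ (𝔮 : Primes Q) (a : Q), ∃ b, IsBoundedBy (bound Q 𝔮 a) b
  /-- (c) homomorphism: unit -/
  fmap_one : fmap Q 1 = 1
  /-- (c) homomorphism: products -/
  fmap_mul : ∀ a b : Q, fmap Q (a * b) = fmap Q a * fmap Q b
  /-- (c) injective -/
  fmap_injective : Injective (fmap Q)
  /-- (c) image in `∏ Q_𝔮` -/
  fmap_mem_range : ∀ a : Q, fmap Q a ∈ Set.range (pToR Q)
  /-- (d_ord): `fmap a · x = fmap b` with `x ∈ ∏ Q_𝔮` forces `a ≤ b` in `Q` -/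
  dvd_of_fmap_mul_eq : ∀ (a b : Q) (x : PFactor Q), fmap Q a * pToR Q x = fmap Q b → a ∣ b
  /-- (d_res): the restriction of `fmap b` to any set of primes is an `fmap c` -/
  exists_restrict : ∀ (b : Q) (S : Set (Primes Q)), ∃ c : Q,
    ∀ 𝔮, (𝔮 ∈ S → fmap Q c 𝔮 = fmap Q b 𝔮) ∧ (𝔮 ∉ S → fmap Q c 𝔮 = 1)

/-- **Condition (d_cof)** ([EtTh] proof of Lemma 3.5, p.75: "for every `a ∈ P^rlf`, there exists an
`a' ∈ P^pf` such that `a' ≥ a`") for `Q` in the role of `M^pf`: every element of `∏_𝔮 Q_𝔮 ⊗ ℝ≥0` whose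
support lies inside the support of some `fmap b` — i.e. every element of the realification — lies BELOW
some `fmap b'`. [cite: MochizukiEtTh2009, Lem 3.5 p.75] -/
structure Cofinal : Prop where
  /-- every element of `∏ Q_𝔮 ⊗ ℝ≥0` supported inside some `Supp(fmap b)` lies below some `fmap b'` -/
  out : ∀ (x : RFactor Q) (b : Q), supp x ⊆ supp (fmap Q b) → ∃ b' : Q, x ∣ fmap Q b'

variable {Q} {Q' : Type u} [CommMonoid Q']

/-- **(c) + (d_ord) + (d_res) are invariant under isomorphisms of monoids** (weak twin of
`Cond.of_mulEquiv`). [cite: MochizukiFrdI2008, Def. 2.4(i) p.47] -/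
theorem CondWeak.of_mulEquiv (e : Q ≃* Q') (hc : CondWeak Q) : CondWeak Q' where
  bounded 𝔮' a' := by
    obtain ⟨a, rfl⟩ := e.surjective a'
    obtain ⟨b, hb⟩ := hc.bounded (pre e 𝔮') a
    rw [bound_congr e (pre e 𝔮') 𝔮' (congr_pre e 𝔮') a]
    exact ⟨_, (isBoundedBy_image_iff _ _ b).mpr hb⟩
  fmap_one := by rw [← map_one e, fmap_congr, hc.fmap_one, map_one]
  fmap_mul a' b' := by
    obtain ⟨a, rfl⟩ := e.surjective a'
    obtain ⟨b, rfl⟩ := e.surjective b'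
    rw [← map_mul, fmap_congr, fmap_congr, fmap_congr, hc.fmap_mul, map_mul]
  fmap_injective a' b' hab := by
    obtain ⟨a, rfl⟩ := e.surjective a'
    obtain ⟨b, rfl⟩ := e.surjective b'
    rw [fmap_congr, fmap_congr] at hab
    rw [hc.fmap_injective (piR_injective e hab)]
  fmap_mem_range a' := by
    obtain ⟨a, rfl⟩ := e.surjective a'
    obtain ⟨x, hx⟩ := hc.fmap_mem_range a
    exact ⟨piP e x, by rw [fmap_congr, ← hx, piR_pToR]⟩
  dvd_of_fmap_mul_eq a' b' x' he := by
    obtain ⟨a, rfl⟩ := e.surjective a'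
    obtain ⟨b, rfl⟩ := e.surjective b'
    obtain ⟨x, rfl⟩ := piP_surjective e x'
    rw [fmap_congr, fmap_congr, ← piR_pToR, ← map_mul] at he
    exact map_dvd e (hc.dvd_of_fmap_mul_eq a b x (piR_injective e he))
  exists_restrict b' S' := by
    obtain ⟨b, rfl⟩ := e.surjective b'
    obtain ⟨c, hc'⟩ := hc.exists_restrict b ((Primes.congr e) ⁻¹' S')
    refine ⟨e c, fun 𝔮' => ⟨fun hS => ?_, fun hS => ?_⟩⟩
    · have h𝔮 : pre e 𝔮' ∈ (Primes.congr e) ⁻¹' S' := by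
        rw [Set.mem_preimage, congr_pre]; exact hS
      rw [fmap_congr, fmap_congr, piR_apply, piR_apply, (hc' (pre e 𝔮')).1 h𝔮]
    · have h𝔮 : pre e 𝔮' ∉ (Primes.congr e) ⁻¹' S' := by
        rw [Set.mem_preimage, congr_pre]; exact hS
      rw [fmap_congr, piR_apply, (hc' (pre e 𝔮')).2 h𝔮, map_one]

/-- (c) + (d_ord) + (d_res) for `Q` iff for `Q' ≅ Q`. [cite: MochizukiFrdI2008, Def. 2.4(i) p.47] -/
theorem condWeak_congr_iff (e : Q ≃* Q') : CondWeak Q ↔ CondWeak Q' :=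
  ⟨CondWeak.of_mulEquiv e, CondWeak.of_mulEquiv e.symm⟩

/-- **(d_cof) is invariant under isomorphisms of monoids.** [cite: MochizukiEtTh2009, Lem 3.5 p.75] -/
theorem Cofinal.of_mulEquiv (e : Q ≃* Q') (hcof : Cofinal Q) : Cofinal Q' := by
  refine ⟨fun x' b' hsupp => ?_⟩
  obtain ⟨x, rfl⟩ := piR_surjective e x'
  obtain ⟨b, rfl⟩ := e.surjective b'
  rw [fmap_congr, supp_piR, supp_piR,
    (Primes.congr e.symm).surjective.preimage_subset_preimage_iff] at hsupp
  obtain ⟨b₁, hb₁⟩ := hcof.out x b hsupp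
  exact ⟨e b₁, by rw [fmap_congr]; exact map_dvd (piR e) hb₁⟩

/-- (d_cof) for `Q` iff for `Q' ≅ Q`. [cite: MochizukiEtTh2009, Lem 3.5 p.75] -/
theorem cofinal_congr_iff (e : Q ≃* Q') : Cofinal Q ↔ Cofinal Q' :=
  ⟨Cofinal.of_mulEquiv e, Cofinal.of_mulEquiv e.symm⟩

end Factorization

/-! ### `Q = M^pf`: the weak data of `PerfFactorialWeak.lean`, definitionally -/

section Bridge

variable {M : Type u} [CommMonoid M]

/-- **`M` is weakly perf-factorial iff `M` is divisorial, every `M_𝔭` is monoprime, and (c) + (d_ord) +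
(d_res) hold for `M^pf`** — the weak Def. 2.4 (i) regrouped (weak twin of `isPerfFactorial_iff`).
[cite: MochizukiFrdI2008, Def. 2.4(i) p.47] -/
theorem isPerfFactorialWeak_iff :
    IsPerfFactorialWeak M ↔ IsDivisorial M ∧ (∀ 𝔭 : Primes M, IsMonoprime ↥𝔭.submonoid) ∧
      Factorization.CondWeak (Perfection M) := by
  constructor
  · intro h
    exact ⟨h.isDivisorial, h.isMonoprime,
      { bounded := h.bounded
        fmap_one := h.factorMap_one
        fmap_mul := h.factorMap_mul
        fmap_injective := h.factorMap_injective
        fmap_mem_range := h.factorMap_mem_range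
        dvd_of_fmap_mul_eq := h.dvd_of_factorMap_mul_eq'
        exists_restrict := h.exists_restrict }⟩
  · rintro ⟨h₁, h₂, h₃⟩
    exact
      { isDivisorial := h₁
        isMonoprime := h₂
        bounded := h₃.bounded
        factorMap_one := h₃.fmap_one
        factorMap_mul := h₃.fmap_mul
        factorMap_injective := h₃.fmap_injective
        factorMap_mem_range := h₃.fmap_mem_range
        dvd_of_factorMap_mul_eq' := h₃.dvd_of_fmap_mul_eq
        exists_restrict := h₃.exists_restrict }

/-- Assembling `IsPerfFactorialWeak` from the three parts. [cite: MochizukiFrdI2008, Def. 2.4(i) p.47] -/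
theorem IsPerfFactorialWeak.of_condWeak (h₁ : IsDivisorial M)
    (h₂ : ∀ 𝔭 : Primes M, IsMonoprime ↥𝔭.submonoid) (h₃ : Factorization.CondWeak (Perfection M)) :
    IsPerfFactorialWeak M :=
  isPerfFactorialWeak_iff.mpr ⟨h₁, h₂, h₃⟩

/-- The (c)(d_ord)(d_res) part of a weakly perf-factorial monoid. [cite: MochizukiFrdI2008, Def. 2.4(i) p.47] -/
theorem IsPerfFactorialWeak.condWeak (h : IsPerfFactorialWeak M) : Factorization.CondWeak (Perfection M) :=
  (isPerfFactorialWeak_iff.mp h).2.2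

/-- **(d_cof) on `M^rlf` is `Factorization.Cofinal (M^pf)`**: "every element of `M^rlf` lies below the
image of an element of `M^pf`" (the clause `RlfCofinal` of `IsPerfFactorialCof`, [EtTh] p.75), read in
`M^rlf_factor` — divisibility in `M^rlf ⊆ M^rlf_factor` being componentwise with admissible support.
[cite: MochizukiEtTh2009, Lem 3.5 p.75] -/
theorem IsPerfFactorialWeak.rlfCofinal_iff (h : IsPerfFactorialWeak M) :
    (∀ x : h.Rlf, ∃ b : Perfection M, x ∣ h.toRealification b) ↔
      Factorization.Cofinal (Perfection M) := by
  constructor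
  · intro hcof
    refine ⟨fun x b hsupp => ?_⟩
    obtain ⟨b', hb'⟩ := hcof ⟨x, b, hsupp⟩
    exact ⟨b', map_dvd h.realification.subtype hb'⟩
  · intro hcof x
    obtain ⟨b, hb⟩ := x.2
    obtain ⟨b', t, ht⟩ := hcof.out x.1 b hb
    -- the quotient `t` has admissible support, so the divisibility holds inside `M^rlf`
    have htmem : t ∈ h.realification := by
      refine ⟨b', fun 𝔮 h𝔮 => ?_⟩
      have hsub := supp_subset_supp_mul t x.1 h𝔮
      rw [mul_comm] at hsub
      show 𝔮 ∈ supp (factorMap M b')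
      rw [factorMap_eq, ht]
      exact hsub
    exact ⟨b', ⟨t, htmem⟩, Subtype.ext ht⟩

end Bridge

/-! ### Isomorphism invariance of the weak notion and of (d_cof) -/

section Transport

variable {M M' : Type u} [CommMonoid M] [CommMonoid M']

/-- **`IsPerfFactorialWeak` transports along `M ≅ M'`** (weak twin of the isomorphism invariance of
`IsPerfFactorial`: divisoriality and monoprimality of the `M_𝔭` by `MonoidTransport.lean`, (c) + (d_ord) +
(d_res) by `Factorization.CondWeak.of_mulEquiv`). [cite: MochizukiFrdI2008, Def. 2.4(i) p.47] -/
theorem IsPerfFactorialWeak.of_mulEquiv (e : M ≃* M') (h : IsPerfFactorialWeak M) :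
    IsPerfFactorialWeak M' := by
  refine IsPerfFactorialWeak.of_condWeak (h.isDivisorial.of_mulEquiv e) (fun 𝔭' => ?_)
    (Factorization.CondWeak.of_mulEquiv (Perfection.congr e) h.condWeak)
  exact (h.isMonoprime (Primes.congr e.symm 𝔭')).of_mulEquiv
    (Primes.submonoidCongr e (Primes.congr e.symm 𝔭') 𝔭' (Primes.congr_apply_congr_symm e 𝔭'))

/-- **(d_cof) transports along `M ≅ M'`**: if `M^pf` is cofinal in `M^rlf`, so is `M'^pf` in `M'^rlf` (for
the transported weak structure — any two proofs of `IsPerfFactorialWeak M'` have the same `Rlf`).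
[cite: MochizukiEtTh2009, Lem 3.5 p.75] -/
theorem IsPerfFactorialWeak.rlfCofinal_of_mulEquiv (e : M ≃* M') (h : IsPerfFactorialWeak M)
    (hcof : ∀ x : h.Rlf, ∃ b : Perfection M, x ∣ h.toRealification b) (h' : IsPerfFactorialWeak M') :
    ∀ x : h'.Rlf, ∃ b : Perfection M', x ∣ h'.toRealification b :=
  h'.rlfCofinal_iff.mpr (Factorization.Cofinal.of_mulEquiv (Perfection.congr e) (h.rlfCofinal_iff.mp hcof))

end Transport

/-! ### "`M^pf` is (weakly) perf-factorial", with cofinality -/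

section PerfectionWeak

variable {M : Type u} [CommMonoid M]

/-- **Def. 2.4 (i), p. 48, weak form: `M^pf` is weakly perf-factorial** when `M` is: (a) `M^pf` is
divisorial; (b) every `(M^pf)_𝔮 ≅ (M_𝔭)^pf` is monoprime; (c) + (d_ord) + (d_res) are transported along
`M^pf ≅ (M^pf)^pf` (`M^pf` perfect). [cite: MochizukiFrdI2008, Def. 2.4(i) p.48] -/
theorem IsPerfFactorialWeak.perfection (h : IsPerfFactorialWeak M) : IsPerfFactorialWeak (Perfection M) :=
  IsPerfFactorialWeak.of_condWeak h.isDivisorial.perfection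
    (isMonoprime_submonoid_primes_perfection h.isDivisorial.isSharp h.isMonoprime)
    (Factorization.CondWeak.of_mulEquiv (isPerfect_perfection (M := M)).equivPerfection h.condWeak)

/-- **(d_cof) passes to `M^pf`**: if `M^pf` is cofinal in `M^rlf` then `(M^pf)^pf` is cofinal in
`(M^pf)^rlf`. [cite: MochizukiEtTh2009, Lem 3.5 p.75] -/
theorem IsPerfFactorialWeak.rlfCofinal_perfection (h : IsPerfFactorialWeak M)
    (hcof : ∀ x : h.Rlf, ∃ b : Perfection M, x ∣ h.toRealification b) :
    ∀ x : h.perfection.Rlf, ∃ b : Perfection (Perfection M), x ∣ h.perfection.toRealification b :=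
  h.perfection.rlfCofinal_iff.mpr
    (Factorization.Cofinal.of_mulEquiv (isPerfect_perfection (M := M)).equivPerfection
      (h.rlfCofinal_iff.mp hcof))

end PerfectionWeak

end Literature.AlgebraicGeometry.Frobenioids
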